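import Summits.ValiantsHypothesis.ValiantsHypothesis.Theses.BarrierLever
import Summits.ValiantsHypothesis.ValiantsHypothesis.Theorems.BarrierLeverPriorityPeelingShearMove

/-!
# Route BarrierLever — item 19760 `ColumnShearSound` (the column shear of the PP calculus, by name)

Item `stmt-ValiantsHypothesis-19760` (support, rank 9; planner p1-g11; cell valiant-natproofs, rung V4,
𝒟-side door (c)): the COLUMN SHEAR of prover gen 7's priority-peeling calculus in MAP encoding and
WITHOUT an injectivity hypothesis on the column maps. For column literals `x ≠ y` the sheared
configuration replaces `x` by `y` in place in every column containing `x` but not `y`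
(`fun c => if κ j c = x ∧ (∀ c', κ j c' ≠ y) then y else κ j c`); ALIVE(sheared) ⇒ ALIVE(original).

**Proof.** If every column map `κ j` is injective this is gen 7's kernel theorem
`PriorityPeeling.shearMove` (`…Theorems.BarrierLeverPriorityPeelingShearMove`, p458897) with
`aff j := [x ∈ κ j ∌ y]` and `qx j :=` the unique `x`-slot: on an injective column
`Function.update (κ j) (qx j) y` is the item's `if`-map. If some `κ j₀` repeats a literal, the
SHEARED column `j₀` repeats a literal as well (the `if` takes the same branch at both slots), so every
minor through it vanishes, the sheared layout matrix has a zero column for EVERY `G`, and the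
hypothesis is absurd. (`d = 0` is degenerate: the sheared maps are the original ones.)

WHAT THIS IS NOT: one elementary reduction step; with items 19759 (pair move) and 19766 (glue, closed)
it reduces TT (item 19152) to the combinatorial conjecture 19761. Nothing on crux
stmt-ValiantsHypothesis-14610 or on VP vs VNP.
-/

-- layout Summits/ValiantsHypothesis/ValiantsHypothesis forces the duplicated namespace component
set_option linter.dupNamespace false

namespace Summit.ValiantsHypothesis.ValiantsHypothesis.Theorems.BarrierLever.ColumnShear

open Matrix

/-- A column map repeating a literal kills every minor through it, hence the whole layout column:
the layout determinant vanishes for every `G`. -/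
theorem layoutDet_eq_zero_of_not_injective {nr nc r d : ℕ} (ρ : Fin r → Fin d → Fin nr)
    (κ : Fin r → Fin d → Fin nc) (j₀ : Fin r) (c₁ c₂ : Fin d) (hne : c₁ ≠ c₂)
    (heq : κ j₀ c₁ = κ j₀ c₂) (G : Matrix (Fin nr) (Fin nc) ℂ) :
    (Matrix.of fun i j : Fin r => (G.submatrix (ρ i) (κ j)).det).det = 0 := by
  refine Matrix.det_eq_zero_of_column_eq_zero j₀ (fun i => ?_)
  rw [Matrix.of_apply]
  exact Matrix.det_zero_of_column_eq hne (fun a => by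
    simp only [Matrix.submatrix_apply, heq])

/-- **Item 19760 `ColumnShearSound`** (the route decl, by name). -/
theorem columnShearSound : Theses.BarrierLever.ColumnShearSound := by
  classical
  intro nr nc r d ρ κ x y hxy hsh
  -- the sheared column maps
  set κ' : Fin r → Fin d → Fin nc :=
    fun j c => if κ j c = x ∧ (∀ c' : Fin d, κ j c' ≠ y) then y else κ j c with hκ'
  have hsh' : ∃ G : Matrix (Fin nr) (Fin nc) ℂ,
      (Matrix.of fun i j : Fin r => (G.submatrix (ρ i) (κ' j)).det).det ≠ 0 := hsh
  by_cases hinj : ∀ j, Function.Injective (κ j)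
  · -- all columns injective: gen 7's `shearMove`
    cases d with
    | zero =>
      -- no slots: the sheared maps are the original maps
      have hκκ : κ' = κ := by
        funext j c
        exact Fin.elim0 c
      rw [hκκ] at hsh'
      exact hsh'
    | succ d =>
      let aff : Fin r → Bool := fun j => decide ((∃ c, κ j c = x) ∧ ∀ c', κ j c' ≠ y)
      let qx : Fin r → Fin (d + 1) := fun j =>
        if h : ∃ c, κ j c = x then Classical.choose h else 0
      have hqx : ∀ j, (∃ c, κ j c = x) → κ j (qx j) = x := by
        intro j h
        simp only [qx, dif_pos h]
        exact Classical.choose_spec h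
      have haff : ∀ j, aff j = true → κ j (qx j) = x ∧ ∀ q, κ j q ≠ y := by
        intro j hj
        have h := of_decide_eq_true hj
        exact ⟨hqx j h.1, h.2⟩
      have hunaff : ∀ j, aff j = false → (∀ q, κ j q ≠ x) ∨ (∃ q, κ j q = y) := by
        intro j hj
        have h : ¬ ((∃ c, κ j c = x) ∧ ∀ c', κ j c' ≠ y) := of_decide_eq_false hj
        by_cases hx : ∃ c, κ j c = x
        · right
          by_contra hy
          push Not at hy
          exact h ⟨hx, hy⟩
        · left
          intro q hq
          exact hx ⟨q, hq⟩
      -- the item's `if`-map is `shearMove`'s update map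
      have hmaps : ∀ j, κ' j = (if aff j then Function.update (κ j) (qx j) y else κ j) := by
        intro j
        funext c
        simp only [hκ']
        cases hj : aff j
        · have h : ¬ ((∃ c, κ j c = x) ∧ ∀ c', κ j c' ≠ y) := of_decide_eq_false hj
          have hc : ¬ (κ j c = x ∧ ∀ c' : Fin (d + 1), κ j c' ≠ y) :=
            fun hc => h ⟨⟨c, hc.1⟩, hc.2⟩
          rw [if_neg hc]
          simp
        · obtain ⟨hx, hy⟩ := haff j hj
          simp only [if_true, Function.update_apply]
          by_cases hc : c = qx j
          · subst hc
            rw [if_pos ⟨hx, hy⟩, if_pos rfl]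
          · have hcx : κ j c ≠ x := fun h => hc ((hinj j) (h.trans hx.symm))
            rw [if_neg (fun h => hcx h.1), if_neg hc]
      have hsheared : ∃ G' : Matrix (Fin nr) (Fin nc) ℂ,
          (Matrix.of fun i j : Fin r => (G'.submatrix (ρ i)
            (if aff j then Function.update (κ j) (qx j) y else κ j)).det).det ≠ 0 := by
        obtain ⟨G', hG'⟩ := hsh'
        refine ⟨G', ?_⟩
        have hM : (Matrix.of fun i j : Fin r => (G'.submatrix (ρ i)
            (if aff j then Function.update (κ j) (qx j) y else κ j)).det) =
            Matrix.of fun i j : Fin r => (G'.submatrix (ρ i) (κ' j)).det := by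
          ext i j
          rw [Matrix.of_apply, Matrix.of_apply, hmaps j]
        rw [hM]
        exact hG'
      exact PriorityPeeling.shearMove ρ κ hinj x y hxy aff qx haff hunaff hsheared
  · -- a column repeating a literal: the sheared column repeats it too, hypothesis absurd
    push Not at hinj
    obtain ⟨j₀, hj₀⟩ := hinj
    rw [Function.Injective] at hj₀
    push Not at hj₀
    obtain ⟨c₁, c₂, heq, hne⟩ := hj₀
    have heq' : κ' j₀ c₁ = κ' j₀ c₂ := by
      simp only [hκ', heq]
    obtain ⟨G', hG'⟩ := hsh'
    exact absurd (layoutDet_eq_zero_of_not_injective ρ κ' j₀ c₁ c₂ hne heq' G') hG'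

end Summit.ValiantsHypothesis.ValiantsHypothesis.Theorems.BarrierLever.ColumnShear
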